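import Summits.QuantumFields.YangMills.Theorems.UnitScaleTiltProp7CornerFrameLegsStepZd
import Summits.QuantumFields.YangMills.Theorems.UnitScaleTiltProp7CombAccFrameMassStep
import Literature.MathematicalPhysics.QuantumFieldTheory.Balaban1983to89.T4TermwiseTorus
import Mathlib.Algebra.Order.Chebyshev
import HarnessLib

/-!
# `UnitScaleTiltProp7CornerFrameLegsMassStep` — LANE II (R-LEGS), brick (Br-2′): THE `ℓ²` MASS STEP OF THE FRAME DERIVATIVE ALONG ★routeR-w2's RECURSION —
# `M_{l+1} ≤ 2(Lᵈ)⁻¹·M_l + 2(dL)²·N_l` over one period cell (`M_l := Σ_x ‖D_l(x̂)‖²`, `N_l := Σ_{x,κ} ‖Y_l(x̂,κ)‖²`) — the mass companion of ✓(Br-5′) `legs_step_cell_le`, feeding its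
# big-rectangle slot `16(Lᵈ)⁻¹δ₁²·M_l` (crux `MinimiserStabilityRegPr`, stmt-QuantumFields-19200, EX lane, hN06 LANE II (QB)∕(QH1) supplier (R-LEGS); `--supports stmt-QuantumFields-19200 --as helper`)

Cell `ym3-torus` (HUMAN RULING D-0037: YM₃ on T³ is ladder rung R3 — NOT d = 4, NOT infinite volume, NOT a mass gap, NOT the Clay problem), width seat `ym-ust-20520-w4` (g12), pen of the
curved row `rlegs`.  THEOREMS ONLY (0 `def`, 0 `sorry`); nothing here claims (R-LEGS-cov), (QB), (QH1), (REC), `hN06`, EX or the crux.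

THE STEP.  From `D′(z) = (Lᵈ)⁻¹•Σ_r [tsum V Y (L•z) Γ_r + R(V(L•z; Γ_r))·D(L•z + r)]` (`V`, `R(·)` bi-contractive): `‖D′(z)‖ ≤ (Lᵈ)⁻¹Σ_r (asum ‖Y‖ (L•z) Γ_r + ‖D(L•z + r)‖)`, square with
the box Cauchy–Schwarz, `(asum ‖Y‖)² ≤ (dL)²·Σ_{box bonds}‖Y‖²` (✓`Prop7CornerFrameLegsStepZd.sq_asum_treeWord_boxVec_le`), and tile (★routeR-w6 ✓`sum_blockLift_eq`).
* ★★ `mass_step_cell_le` — the title (no periodicity needed: every label read is a block label).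
HONEST SCOPE.  Bookkeeping; rung R3; nothing of the crux ∕ the gap is claimed.

References: T. Bałaban, CMP 98 (1985) 17–51 [Balaban1985Averaging] ((58) p.27, (97) p.32, (160)–(163) p.42); CMP 109 (1987) 249–301 [Balaban1987RG1] ((0.3) p.252).
-/

set_option autoImplicit false

noncomputable section

open scoped BigOperators

namespace Summit.QuantumFields.YangMills.Theorems.Prop7CornerFrameLegsMassStep

open Finset
open Literature.MathematicalPhysics.QuantumFieldTheory.Balaban1983to89
open B7Prop1Explicit (e hol U1 mem_U1 hol_mem asum treeWord boxVec)
open B7Eq78Linearization (conjR)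
open B7Prop3GeneralRotated (tsum norm_conjR_le)
open Summit.QuantumFields.YangMills.Theorems.Prop7CornerFrameLegsLetters (norm_tsum_le_asum asum_nonneg_of_forward)
open Summit.QuantumFields.YangMills.Theorems.Prop7CornerFrameLegsStepZd (sq_asum_treeWord_boxVec_le)
open B7Prop10InLambda (treeWord_boxVec_pos)

open Summit.QuantumFields.YangMills.Theorems.Prop7CombAccFrameMassStep (valLift_blockSite sum_blockLift_eq)

variable {P : Params} {l : ℕ} {𝔸 : Type*} [NormedRing 𝔸] [NormOneClass 𝔸] [NormedAlgebra ℂ 𝔸]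

/-- ★★ **THE `ℓ²` MASS STEP OF THE FRAME DERIVATIVE**: `Σ_{z : Site P (l+1)} ‖D′(ẑ)‖² ≤ 2(Lᵈ)⁻¹·Σ_{x : Site P l}‖D(x̂)‖² + 2(dL)²·Σ_{x : Site P l}Σ_κ‖Y(x̂,κ)‖²` along ★routeR-w2's recursion
(`V` in `U1`). [cite: Balaban1985Averaging, (58) p.27, (97) p.32, (163) p.42; Balaban1987RG1, (0.3) p.252] -/
theorem mass_step_cell_le (hl : l + 1 ≤ P.m + P.K) {V : (Fin P.d → ℤ) → Fin P.d → 𝔸ˣ} (hV : ∀ x κ, V x κ ∈ U1 𝔸)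
    (Y : (Fin P.d → ℤ) → Fin P.d → 𝔸) (D D' : (Fin P.d → ℤ) → 𝔸)
    (hrec : ∀ z : Fin P.d → ℤ, D' z = ((Fintype.card (Fin P.d → Fin P.L) : ℂ))⁻¹ • ∑ r : Fin P.d → Fin P.L,
      (tsum V Y ((P.L : ℤ) • z) (treeWord (boxVec P.L r)) + conjR (hol V ((P.L : ℤ) • z) (treeWord (boxVec P.L r))) (D ((P.L : ℤ) • z + boxVec P.L r)))) :
    ∑ z : Site P (l + 1), ‖D' (fun ν => ((z ν).val : ℤ))‖ ^ 2
      ≤ 2 * ((P.L : ℝ) ^ P.d)⁻¹ * ∑ x : Site P l, ‖D (fun ν => ((x ν).val : ℤ))‖ ^ 2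
        + 2 * ((P.d * P.L : ℕ) : ℝ) ^ 2 * ∑ x : Site P l, ∑ κ : Fin P.d, ‖Y (fun ν => ((x ν).val : ℤ)) κ‖ ^ 2 := by
  have hLpos : 0 < P.L := P.L_pos
  have hL0 : (0 : ℝ) < (P.L : ℝ) := Nat.cast_pos.2 hLpos
  have hLd : (0 : ℝ) < (P.L : ℝ) ^ P.d := pow_pos hL0 _
  have hcard : (Fintype.card (Fin P.d → Fin P.L) : ℝ) = (P.L : ℝ) ^ P.d := by
    rw [Fintype.card_fun, Fintype.card_fin, Fintype.card_fin]; push_cast; ring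
  have hcnorm : ‖((Fintype.card (Fin P.d → Fin P.L) : ℂ))⁻¹‖ = ((P.L : ℝ) ^ P.d)⁻¹ := by
    rw [norm_inv, Complex.norm_natCast, hcard]
  have hfw : ∀ r : Fin P.d → Fin P.L, ∀ lt ∈ treeWord (boxVec P.L r), lt.2 = true := treeWord_boxVec_pos P.L
  have hcardR : ((Finset.univ : Finset (Fin P.d → Fin P.L)).card : ℝ) = (P.L : ℝ) ^ P.d := by rw [Finset.card_univ]; exact_mod_cast hcard
  -- pointwise: `‖D′(ẑ)‖ ≤ (Lᵈ)⁻¹ Σ_r (asum ‖Y‖ + ‖D‖)`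
  have hpt : ∀ z : Site P (l + 1), ‖D' (fun ν => ((z ν).val : ℤ))‖
      ≤ ((P.L : ℝ) ^ P.d)⁻¹ * ∑ r : Fin P.d → Fin P.L,
        (asum (fun y κ => ‖Y y κ‖) ((P.L : ℤ) • (fun ν => ((z ν).val : ℤ))) (treeWord (boxVec P.L r)) + ‖D (fun ν => (((Site.blockSite z r) ν).val : ℤ))‖) := by
    intro z
    rw [hrec, norm_smul, hcnorm]
    refine mul_le_mul_of_nonneg_left ((norm_sum_le _ _).trans (Finset.sum_le_sum fun r _ => ?_)) (by positivity)
    refine (norm_add_le _ _).trans (add_le_add ?_ ?_)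
    · exact norm_tsum_le_asum hV (fun _ _ => le_rfl) _ _ (hfw r)
    · rw [← valLift_blockSite hl z r]
      exact norm_conjR_le (hol_mem hV _ _) _
  -- square + box Cauchy–Schwarz + `(a+b)² ≤ 2a² + 2b²`
  have hsq : ∀ z : Site P (l + 1), ‖D' (fun ν => ((z ν).val : ℤ))‖ ^ 2
      ≤ ((P.L : ℝ) ^ P.d)⁻¹ * ∑ r : Fin P.d → Fin P.L,
        (2 * asum (fun y κ => ‖Y y κ‖) ((P.L : ℤ) • (fun ν => ((z ν).val : ℤ))) (treeWord (boxVec P.L r)) ^ 2 + 2 * ‖D (fun ν => (((Site.blockSite z r) ν).val : ℤ))‖ ^ 2) := by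
    intro z
    have h := hpt z
    have hcs := sq_sum_le_card_mul_sum_sq (s := (Finset.univ : Finset (Fin P.d → Fin P.L)))
      (f := fun r => asum (fun y κ => ‖Y y κ‖) ((P.L : ℤ) • (fun ν => ((z ν).val : ℤ))) (treeWord (boxVec P.L r)) + ‖D (fun ν => (((Site.blockSite z r) ν).val : ℤ))‖)
    rw [hcardR] at hcs
    have h2 : ∑ r : Fin P.d → Fin P.L, (asum (fun y κ => ‖Y y κ‖) ((P.L : ℤ) • (fun ν => ((z ν).val : ℤ))) (treeWord (boxVec P.L r)) + ‖D (fun ν => (((Site.blockSite z r) ν).val : ℤ))‖) ^ 2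
        ≤ ∑ r : Fin P.d → Fin P.L, (2 * asum (fun y κ => ‖Y y κ‖) ((P.L : ℤ) • (fun ν => ((z ν).val : ℤ))) (treeWord (boxVec P.L r)) ^ 2 + 2 * ‖D (fun ν => (((Site.blockSite z r) ν).val : ℤ))‖ ^ 2) :=
      Finset.sum_le_sum fun r _ => by nlinarith [sq_nonneg (asum (fun y κ => ‖Y y κ‖) ((P.L : ℤ) • (fun ν => ((z ν).val : ℤ))) (treeWord (boxVec P.L r)) - ‖D (fun ν => (((Site.blockSite z r) ν).val : ℤ))‖)]
    calc ‖D' (fun ν => ((z ν).val : ℤ))‖ ^ 2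
        ≤ (((P.L : ℝ) ^ P.d)⁻¹ * ∑ r : Fin P.d → Fin P.L, (asum (fun y κ => ‖Y y κ‖) ((P.L : ℤ) • (fun ν => ((z ν).val : ℤ))) (treeWord (boxVec P.L r)) + ‖D (fun ν => (((Site.blockSite z r) ν).val : ℤ))‖)) ^ 2 :=
          pow_le_pow_left₀ (norm_nonneg _) h 2
      _ ≤ ((P.L : ℝ) ^ P.d)⁻¹ * ∑ r : Fin P.d → Fin P.L, (asum (fun y κ => ‖Y y κ‖) ((P.L : ℤ) • (fun ν => ((z ν).val : ℤ))) (treeWord (boxVec P.L r)) + ‖D (fun ν => (((Site.blockSite z r) ν).val : ℤ))‖) ^ 2 := by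
          rw [mul_pow, sq]
          calc ((P.L : ℝ) ^ P.d)⁻¹ * ((P.L : ℝ) ^ P.d)⁻¹ * (∑ r : Fin P.d → Fin P.L, _) ^ 2
              ≤ ((P.L : ℝ) ^ P.d)⁻¹ * ((P.L : ℝ) ^ P.d)⁻¹ * ((P.L : ℝ) ^ P.d * ∑ r : Fin P.d → Fin P.L, _ ^ 2) := mul_le_mul_of_nonneg_left hcs (by positivity)
            _ = _ := by field_simp
      _ ≤ _ := mul_le_mul_of_nonneg_left h2 (by positivity)
  -- the source through the box, then the tiling
  have hA : ∀ (z : Site P (l + 1)) (r : Fin P.d → Fin P.L), asum (fun y κ => ‖Y y κ‖) ((P.L : ℤ) • (fun ν => ((z ν).val : ℤ))) (treeWord (boxVec P.L r)) ^ 2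
      ≤ ((P.d * P.L : ℕ) : ℝ) ^ 2 * ∑ s : Fin P.d → Fin P.L, ∑ κ : Fin P.d, ‖Y (fun ν => (((Site.blockSite z s) ν).val : ℤ)) κ‖ ^ 2 := by
    intro z r
    have h := sq_asum_treeWord_boxVec_le P.L (f := fun y κ => ‖Y y κ‖) (fun _ _ => norm_nonneg _) ((P.L : ℤ) • (fun ν => ((z ν).val : ℤ))) r
    refine h.trans (le_of_eq ?_)
    congr 1
    refine Finset.sum_congr rfl fun s _ => ?_
    rw [valLift_blockSite hl z s]
  have hNsum : ∑ z : Site P (l + 1), ∑ s : Fin P.d → Fin P.L, ∑ κ : Fin P.d, ‖Y (fun ν => (((Site.blockSite z s) ν).val : ℤ)) κ‖ ^ 2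
      = ∑ x : Site P l, ∑ κ : Fin P.d, ‖Y (fun ν => ((x ν).val : ℤ)) κ‖ ^ 2 :=
    sum_blockLift_eq hl (fun x => ∑ κ : Fin P.d, ‖Y x κ‖ ^ 2)
  have hMsum : ∑ z : Site P (l + 1), ∑ r : Fin P.d → Fin P.L, ‖D (fun ν => (((Site.blockSite z r) ν).val : ℤ))‖ ^ 2
      = ∑ x : Site P l, ‖D (fun ν => ((x ν).val : ℤ))‖ ^ 2 := sum_blockLift_eq hl (fun x => ‖D x‖ ^ 2)
  calc ∑ z : Site P (l + 1), ‖D' (fun ν => ((z ν).val : ℤ))‖ ^ 2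
      ≤ ∑ z : Site P (l + 1), ((P.L : ℝ) ^ P.d)⁻¹ * ∑ r : Fin P.d → Fin P.L,
          (2 * (((P.d * P.L : ℕ) : ℝ) ^ 2 * ∑ s : Fin P.d → Fin P.L, ∑ κ : Fin P.d, ‖Y (fun ν => (((Site.blockSite z s) ν).val : ℤ)) κ‖ ^ 2)
            + 2 * ‖D (fun ν => (((Site.blockSite z r) ν).val : ℤ))‖ ^ 2) := by
        refine Finset.sum_le_sum fun z _ => (hsq z).trans (mul_le_mul_of_nonneg_left (Finset.sum_le_sum fun r _ => ?_) (by positivity))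
        linarith [hA z r]
    _ = 2 * ((P.d * P.L : ℕ) : ℝ) ^ 2 * ∑ z : Site P (l + 1), ∑ s : Fin P.d → Fin P.L, ∑ κ : Fin P.d, ‖Y (fun ν => (((Site.blockSite z s) ν).val : ℤ)) κ‖ ^ 2
        + 2 * ((P.L : ℝ) ^ P.d)⁻¹ * ∑ z : Site P (l + 1), ∑ r : Fin P.d → Fin P.L, ‖D (fun ν => (((Site.blockSite z r) ν).val : ℤ))‖ ^ 2 := by
        rw [Finset.mul_sum, Finset.mul_sum, ← Finset.sum_add_distrib]
        refine Finset.sum_congr rfl fun z _ => ?_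
        simp only [mul_add, Finset.sum_add_distrib, Finset.sum_const, Finset.card_univ, nsmul_eq_mul, ← Finset.mul_sum]
        have hκ : ((Fintype.card (Fin P.d → Fin P.L) : ℕ) : ℝ) = (P.L : ℝ) ^ P.d := hcard
        rw [hκ]
        field_simp
    _ = _ := by rw [hNsum, hMsum]; ring

end Summit.QuantumFields.YangMills.Theorems.Prop7CornerFrameLegsMassStep

end
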